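import Literature.Analysis.FluidPDE.GalerkinEnergyBalanceLongTime
import Summits.AnomalousDissipation.AnomalousDissipation.Theses.DecimationAxis
import HarnessLib

/-!
# Balance toolkit for the crux `DecimationAxis.GalerkinFloor` (stmt-AnomalousDissipation-1582):
# the registered Tools stub `stub_heartBalanceTools` of the line `birth`

Route `AnomalousDissipation/DecimationAxis`, crux `GalerkinFloor` (rank 2), skeleton
`Cruxes/GalerkinFloor/Lines/birth.lean` (sha b3793ea2…), heart stub `stub_uniformGalerkinAnomaly`;
STUB-PLAN `Cruxes/GalerkinFloor/STUB-PLAN-stub_uniformGalerkinAnomaly.md`, Step 0 (balance toolkit).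

Everything here is the `Fin 3` / crux-vocabulary reading of the generic Literature toolkit
`Literature/Analysis/FluidPDE/GalerkinEnergyBalance{,LongTime}.lean` (energy identity, absorbing ball,
`⟨D⟩ = ⟨W⟩`, energy row, cone ⇒ window, truncation ceiling, steady states) for trajectories of the
exact-coupling Galerkin system in the skeleton's currency:

* `IsCoeffTrajectory S ν g c` — values in `galerkinSubspace S`, continuous on `[0, ∞)`, one-sided
  derivative `galerkinRHS S ν g↾S (c t)` on every `[0, T]`;
* `coeffEnergy c t = Σ_{k∈S} ‖c_k(t)‖²`, `coeffDissipation ν c t = ν·4π²·Σ_{k∈S} |k|²‖c_k(t)‖²`.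

A `Cruxes/…/Lines/*.lean` skeleton is not importable, so these three notions are written here as
LOCAL NOTATIONS expanding to the skeleton's §0 bodies verbatim (the skeleton's transparent `def`s
`Birth.IsCoeffTrajectory`, `Birth.coeffEnergy`, `Birth.coeffDissipation` unfold to exactly these terms,
so every statement below is usable in the skeleton by `exact` / after `unfold`).  The dictionary
`isCoeffTrajectory_iff` identifies the trajectory notion with the tree's `IsGalerkinODESolution` from
`c 0`, after which each tool is one line of Literature.

Contents: T1 `isCoeffTrajectory_iff` · T3′ `timeMean_coeffDissipation_eq` · T4/T4′
`coeffEnergy_le_max`, `coeffEnergy_le_of_le` (+ `coeffEnergy_le_gronwall`) · T5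
`longTimeAvg_coeffDissipation_eq_work` · T6/T6′ `timeMean_work_le`, `longTimeAvgSup_work_le` · T7
`window_of_cone` · T8 `coeffDissipation_le_of_subset_freqBall` · T9 `eps_le_of_witness` · T10
`steady_isCoeffTrajectory` · the registered conjunction `stub_heartBalanceTools` (= T1 ∧ T3′ ∧ T4 ∧ T5,
signature registered on stmt-AnomalousDissipation-1582 verbatim).

Sources: ConstantinFoias1988 Ch. 8 (8.5)–(8.9); DoeringFoias2002 §2; FoiasManleyRosaTemam2001 Ch. II,
IV App. B (all folklore at this level).
-/

noncomputable section

-- D-0017: single-problem summit ⇒ the duplicated namespace segment is by design.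
set_option linter.dupNamespace false

open Filter Set MeasureTheory
open Literature.Analysis.FunctionSpaces Literature.Analysis.FunctionSpaces.Torus
open Literature.Analysis.FluidPDE

namespace Summit.AnomalousDissipation.AnomalousDissipation.Theorems.DecimationAxisGalerkinFloor

/-- Lattice frequencies `ℤ³` (local notation, as in the skeleton). -/
local notation "ℤ³" => Fin 3 → ℤ
/-- Fourier coefficient values `ℂ³` (local notation, as in the skeleton). -/
local notation "ℂ³" => EuclideanSpace ℂ (Fin 3)

set_option quotPrecheck false in
/-- The skeleton's `Birth.IsCoeffTrajectory`, body verbatim (local notation). -/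
local notation "IsCoeffTrajectory" =>
  fun (S : Finset ℤ³) (ν : ℝ) (g : ℤ³ → ℂ³) (c : ℝ → ↥S → ℂ³) =>
    (∀ t, c t ∈ galerkinSubspace S) ∧ ContinuousOn c (Set.Ici 0) ∧
      (∀ T : ℝ, ∀ t ∈ Set.Icc (0 : ℝ) T,
        HasDerivWithinAt c (galerkinRHS S ν (fun k => g k) (c t)) (Set.Icc 0 T) t)

set_option quotPrecheck false in
/-- The skeleton's `Birth.coeffEnergy`, body verbatim (local notation): `t ↦ Σ_{k∈S} ‖c_k(t)‖²`. -/
local notation "coeffEnergy" =>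
  fun (c : ℝ → ↥(_ : Finset ℤ³) → ℂ³) (t : ℝ) => ∑ k, ‖c t k‖ ^ 2

set_option quotPrecheck false in
/-- The skeleton's `Birth.coeffDissipation`, body verbatim (local notation):
`t ↦ ν·4π²·Σ_{k∈S} |k|²‖c_k(t)‖²`. -/
local notation "coeffDissipation" =>
  fun (ν : ℝ) (c : ℝ → ↥(_ : Finset ℤ³) → ℂ³) (t : ℝ) =>
    ν * (4 * Real.pi ^ 2 * ∑ k : ↥(_ : Finset ℤ³), freqNormSq (k : ℤ³) * ‖c t k‖ ^ 2)

variable {S : Finset ℤ³} {ν : ℝ} {g : ℤ³ → ℂ³} {c : ℝ → ↥S → ℂ³}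

/-! ## T1 — dictionary -/

/-- **T1 (dictionary).** The skeleton's trajectory notion IS the tree's `IsGalerkinODESolution`
(force coefficients `g↾S`, datum `c 0`). -/
theorem isCoeffTrajectory_iff :
    IsCoeffTrajectory S ν g c ↔ IsGalerkinODESolution ν (fun k : ↥S => g k) (c 0) c :=
  ⟨fun h => ⟨rfl, h.1, h.2.1, h.2.2⟩, fun h => ⟨h.mem, h.continuousOn, h.hasDerivWithinAt⟩⟩

/-- A conjugate-symmetric ambient family restricts to real force coefficients on `S`. -/
theorem isRealCoeff_of_isConjSymm (hg : IsConjSymm g) : IsRealCoeff (fun k : ↥S => g k) :=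
  isRealCoeff_restrict hg

/-- `Σ_{k : ↥S} ‖g k‖² = Σ_{k ∈ S} ‖g k‖²` (subtype sum vs `Finset` sum). -/
theorem sum_norm_sq_coe (S : Finset ℤ³) (g : ℤ³ → ℂ³) :
    ∑ k : ↥S, ‖g k‖ ^ 2 = ∑ k ∈ S, ‖g k‖ ^ 2 :=
  Finset.sum_coe_sort S fun k => ‖g k‖ ^ 2

/-! ## T3′ — the energy identity in running-mean form -/

/-- **T3′.** `⟨D⟩_T = ⟨W⟩_T + (E(0) − E(T))/(2T)` for `T > 0` along any trajectory on a symmetric `S`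
with a real (conjugate-symmetric) force. -/
theorem timeMean_coeffDissipation_eq (hS : ∀ k ∈ S, -k ∈ S) (hg : IsConjSymm g)
    (hc : IsCoeffTrajectory S ν g c) {T : ℝ} (hT : 0 < T) :
    timeMean (coeffDissipation ν c) T =
      timeMean (fun t => ∑ k : ↥S, (inner ℂ (g k) (c t k)).re) T +
        (coeffEnergy c 0 - coeffEnergy c T) / (2 * T) :=
  (isCoeffTrajectory_iff.1 hc).timeMean_dissipation_eq hS (isRealCoeff_restrict hg) hT

/-! ## T4 / T4′ — the absorbing ball (punctured frequency sets, `ν > 0`) -/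

/-- **Exponential relaxation** of the energy to the absorbing level
`ρ_* = (Σ_{k∈S}‖g k‖²)/(4π²ν)²`: `E(t) ≤ ρ_* + (E(0) − ρ_*)e^{−4π²νt}` for `t ≥ 0`. -/
theorem coeffEnergy_le_gronwall (hS : ∀ k ∈ S, -k ∈ S) (h0 : (0 : ℤ³) ∉ S) (hν : 0 < ν)
    (hg : IsConjSymm g) (hc : IsCoeffTrajectory S ν g c) {t : ℝ} (ht : 0 ≤ t) :
    coeffEnergy c t ≤ (∑ k ∈ S, ‖g k‖ ^ 2) / (4 * Real.pi ^ 2 * ν) ^ 2 +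
      (coeffEnergy c 0 - (∑ k ∈ S, ‖g k‖ ^ 2) / (4 * Real.pi ^ 2 * ν) ^ 2) *
        Real.exp (-(4 * Real.pi ^ 2 * ν) * t) := by
  have h := (isCoeffTrajectory_iff.1 hc).energy_le_gronwall hν hS h0 (isRealCoeff_restrict hg) ht
  rwa [sum_norm_sq_coe S g] at h

/-- **T4 (absorbing bound).** `E(t) ≤ max (E 0) ((Σ_{k∈S}‖g k‖²)/(4π²ν)²)` for `t ≥ 0`. -/
theorem coeffEnergy_le_max (hS : ∀ k ∈ S, -k ∈ S) (h0 : (0 : ℤ³) ∉ S) (hν : 0 < ν)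
    (hg : IsConjSymm g) (hc : IsCoeffTrajectory S ν g c) {t : ℝ} (ht : 0 ≤ t) :
    coeffEnergy c t ≤ max (coeffEnergy c 0) ((∑ k ∈ S, ‖g k‖ ^ 2) / (4 * Real.pi ^ 2 * ν) ^ 2) := by
  have h := (isCoeffTrajectory_iff.1 hc).energy_le_max hν hS h0 (isRealCoeff_restrict hg) ht
  rwa [sum_norm_sq_coe S g] at h

/-- **T4′ (forward-invariant energy balls).** If `E(0) ≤ R` and `R ≥ (Σ_{k∈S}‖g k‖²)/(4π²ν)²` then
`E(t) ≤ R` for all `t ≥ 0`. -/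
theorem coeffEnergy_le_of_le (hS : ∀ k ∈ S, -k ∈ S) (h0 : (0 : ℤ³) ∉ S) (hν : 0 < ν)
    (hg : IsConjSymm g) (hc : IsCoeffTrajectory S ν g c) {R : ℝ}
    (hR : (∑ k ∈ S, ‖g k‖ ^ 2) / (4 * Real.pi ^ 2 * ν) ^ 2 ≤ R) (hc0 : coeffEnergy c 0 ≤ R)
    {t : ℝ} (ht : 0 ≤ t) : coeffEnergy c t ≤ R :=
  (coeffEnergy_le_max hS h0 hν hg hc ht).trans (max_le hc0 hR)

/-! ## T5 — the long-time balance `⟨D⟩ = ⟨W⟩` -/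

/-- **T5.** `⟨D⟩⁻ = ⟨W⟩⁻` and `⟨D⟩⁺ = ⟨W⟩⁺`: the long-time means of the total dissipation are those
of the injected power `W(t) = Σ_{k∈S} Re⟪g_k, c_k(t)⟫` (punctured symmetric `S`, `ν > 0`, real force). -/
theorem longTimeAvg_coeffDissipation_eq_work (hS : ∀ k ∈ S, -k ∈ S) (h0 : (0 : ℤ³) ∉ S)
    (hν : 0 < ν) (hg : IsConjSymm g) (hc : IsCoeffTrajectory S ν g c) :
    longTimeAvgInf (coeffDissipation ν c) =
        longTimeAvgInf (fun t => ∑ k : ↥S, (inner ℂ (g k) (c t k)).re) ∧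
      longTimeAvgSup (coeffDissipation ν c) =
        longTimeAvgSup (fun t => ∑ k : ↥S, (inner ℂ (g k) (c t k)).re) :=
  ⟨(isCoeffTrajectory_iff.1 hc).longTimeAvgInf_dissipation_eq hν hS h0 (isRealCoeff_restrict hg),
    (isCoeffTrajectory_iff.1 hc).longTimeAvgSup_dissipation_eq hν hS h0 (isRealCoeff_restrict hg)⟩

/-! ## T6 / T6′ — the energy row -/

/-- **T6 (finite-time energy row).** `⟨W⟩_T ≤ (Σ_{k∈S}‖g k‖²)^{1/2} · √⟨E⟩_T` for `T > 0`. -/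
theorem timeMean_work_le (hc : IsCoeffTrajectory S ν g c) {T : ℝ} (hT : 0 < T) :
    timeMean (fun t => ∑ k : ↥S, (inner ℂ (g k) (c t k)).re) T ≤
      Real.sqrt (∑ k ∈ S, ‖g k‖ ^ 2) * Real.sqrt (timeMean (coeffEnergy c) T) := by
  have h := (isCoeffTrajectory_iff.1 hc).timeMean_work_le hT
  rwa [sum_norm_sq_coe S g] at h

/-- **T6′ (long-time energy row).** `⟨W⟩⁺ ≤ (Σ_{k∈S}‖g k‖²)^{1/2} · √⟨E⟩⁺` (punctured symmetric `S`,
`ν > 0`, real force). -/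
theorem longTimeAvgSup_work_le (hS : ∀ k ∈ S, -k ∈ S) (h0 : (0 : ℤ³) ∉ S) (hν : 0 < ν)
    (hg : IsConjSymm g) (hc : IsCoeffTrajectory S ν g c) :
    longTimeAvgSup (fun t => ∑ k : ↥S, (inner ℂ (g k) (c t k)).re) ≤
      Real.sqrt (∑ k ∈ S, ‖g k‖ ^ 2) * Real.sqrt (longTimeAvgSup (coeffEnergy c)) := by
  have h := (isCoeffTrajectory_iff.1 hc).longTimeAvgSup_work_le hν hS h0 (isRealCoeff_restrict hg)
  rwa [sum_norm_sq_coe S g] at h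

/-! ## T7 — cone ⇒ window -/

/-- **T7.** A `liminf`-mean floor `δ > 0` for the ONE observable `D − λ·E` (`λ > 0`) gives both
clauses of the heart stub with energy budget `(Σ_{k∈S}‖g k‖²)/λ²`: `⟨E⟩⁺ ≤ G²/λ²` and `⟨D⟩⁻ ≥ δ`. -/
theorem window_of_cone (hS : ∀ k ∈ S, -k ∈ S) (h0 : (0 : ℤ³) ∉ S) (hν : 0 < ν)
    (hg : IsConjSymm g) (hc : IsCoeffTrajectory S ν g c) {lam δ : ℝ} (hlam : 0 < lam) (hδ : 0 < δ)
    (hcone : δ ≤ longTimeAvgInf (fun t => coeffDissipation ν c t - lam * coeffEnergy c t)) :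
    longTimeAvgSup (coeffEnergy c) ≤ (∑ k ∈ S, ‖g k‖ ^ 2) / lam ^ 2 ∧
      δ ≤ longTimeAvgInf (coeffDissipation ν c) := by
  have h := (isCoeffTrajectory_iff.1 hc).window_of_cone hν hS h0 (isRealCoeff_restrict hg) hlam hδ
    hcone
  rwa [sum_norm_sq_coe S g] at h

/-! ## T8 — the truncation ceiling -/

/-- **T8.** On `S ⊆ freqBall K` the total dissipation is at most `ν·4π²K²` times the energy,
pointwise in time (`|k|² ≤ K²` termwise; `ν ≥ 0`). -/
theorem coeffDissipation_le_of_subset_freqBall {K : ℕ} (hSK : S ⊆ freqBall K) (hν : 0 ≤ ν)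
    (c : ℝ → ↥S → ℂ³) (t : ℝ) :
    coeffDissipation ν c t ≤ ν * (4 * Real.pi ^ 2 * (K : ℝ) ^ 2) * coeffEnergy c t :=
  dissipation_le_of_subset_freqBall hSK hν (c t)

/-! ## T9 — budgets are not free -/

/-- **T9 (energy-row necessity).** Any trajectory with `⟨E⟩⁺ ≤ E₀` and `⟨D⟩⁻ ≥ ε` on a punctured
symmetric `S` (`ν > 0`, real force) has `ε ≤ (Σ_{k∈S}‖g k‖²)^{1/2} · √E₀`. -/
theorem eps_le_of_witness (hS : ∀ k ∈ S, -k ∈ S) (h0 : (0 : ℤ³) ∉ S) (hν : 0 < ν)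
    (hg : IsConjSymm g) (hc : IsCoeffTrajectory S ν g c) {E₀ ε : ℝ}
    (hE : longTimeAvgSup (coeffEnergy c) ≤ E₀) (hε : ε ≤ longTimeAvgInf (coeffDissipation ν c)) :
    ε ≤ Real.sqrt (∑ k ∈ S, ‖g k‖ ^ 2) * Real.sqrt E₀ := by
  have h := (isCoeffTrajectory_iff.1 hc).le_sqrt_mul_sqrt_of_floor hν hS h0 (isRealCoeff_restrict hg)
    hE hε
  rwa [sum_norm_sq_coe S g] at h

/-! ## T10 — steady witnesses -/

/-- **T10 (steady witness reader).** A zero of the Galerkin field in the phase space is a constant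
trajectory, whose long-time mean energy and dissipation are its energy and dissipation. -/
theorem steady_isCoeffTrajectory {a : ↥S → ℂ³} (ha : a ∈ galerkinSubspace S)
    (h0 : galerkinRHS S ν (fun k : ↥S => g k) a = 0) :
    IsCoeffTrajectory S ν g (fun _ => a) ∧
      longTimeAvgSup (coeffEnergy (fun _ : ℝ => a)) = ∑ k : ↥S, ‖a k‖ ^ 2 ∧
      longTimeAvgInf (coeffDissipation ν (fun _ : ℝ => a)) =
        ν * (4 * Real.pi ^ 2 * ∑ k : ↥S, freqNormSq (k : ℤ³) * ‖a k‖ ^ 2) := by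
  have h := isGalerkinODESolution_const (ν := ν) (g := fun k : ↥S => g k) ha h0
  exact ⟨⟨h.mem, h.continuousOn, h.hasDerivWithinAt⟩, longTimeAvgSup_of_eq_const fun _ _ => rfl,
    longTimeAvgInf_of_eq_const fun _ _ => rfl⟩

/-! ## The registered Tools stub -/

/-- **Registered Tools stub `stub_heartBalanceTools`** (crux stmt-AnomalousDissipation-1582, line
`birth`; STUB-PLAN Step 0): the conjunction T1 ∧ T3′ ∧ T4 ∧ T5 — dictionary with
`IsGalerkinODESolution`, the running-mean energy identity, the absorbing ball, and the long-time
balance `⟨D⟩∓ = ⟨W⟩∓` — in the skeleton's vocabulary, signature registered verbatim. -/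
theorem stub_heartBalanceTools :
    (∀ (S : Finset ℤ³) (ν : ℝ) (g : ℤ³ → ℂ³) (c : ℝ → ↥S → ℂ³), IsCoeffTrajectory S ν g c ↔ IsGalerkinODESolution ν (fun k : ↥S => g k) (c 0) c) ∧ (∀ (S : Finset ℤ³), (∀ k ∈ S, -k ∈ S) → ∀ (ν : ℝ) (g : ℤ³ → ℂ³), IsConjSymm g → ∀ c : ℝ → ↥S → ℂ³, IsCoeffTrajectory S ν g c → ∀ T : ℝ, 0 < T → timeMean (coeffDissipation ν c) T = timeMean (fun t => ∑ k : ↥S, (inner ℂ (g k) (c t k)).re) T + (coeffEnergy c 0 - coeffEnergy c T) / (2 * T)) ∧ (∀ (S : Finset ℤ³), (∀ k ∈ S, -k ∈ S) → (0 : ℤ³) ∉ S → ∀ ν : ℝ, 0 < ν → ∀ g : ℤ³ → ℂ³, IsConjSymm g → ∀ c : ℝ → ↥S → ℂ³, IsCoeffTrajectory S ν g c → ∀ t : ℝ, 0 ≤ t → coeffEnergy c t ≤ max (coeffEnergy c 0) ((∑ k ∈ S, ‖g k‖ ^ 2) / (4 * Real.pi ^ 2 * ν) ^ 2)) ∧ (∀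 (S : Finset ℤ³), (∀ k ∈ S, -k ∈ S) → (0 : ℤ³) ∉ S → ∀ ν : ℝ, 0 < ν → ∀ g : ℤ³ → ℂ³, IsConjSymm g → ∀ c : ℝ → ↥S → ℂ³, IsCoeffTrajectory S ν g c → longTimeAvgInf (coeffDissipation ν c) = longTimeAvgInf (fun t => ∑ k : ↥S, (inner ℂ (g k) (c t k)).re) ∧ longTimeAvgSup (coeffDissipation ν c) = longTimeAvgSup (fun t => ∑ k : ↥S, (inner ℂ (g k) (c t k)).re)) :=
  ⟨fun _ _ _ _ => isCoeffTrajectory_iff,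
    fun _ hS _ _ hg _ hc _ hT => timeMean_coeffDissipation_eq hS hg hc hT,
    fun _ hS h0 _ hν _ hg _ hc _ ht => coeffEnergy_le_max hS h0 hν hg hc ht,
    fun _ hS h0 _ hν _ hg _ hc => longTimeAvg_coeffDissipation_eq_work hS h0 hν hg hc⟩

end Summit.AnomalousDissipation.AnomalousDissipation.Theorems.DecimationAxisGalerkinFloor

end
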